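import Literature.IUT.HodgeArakelov.MonoThetaCyclotomes
import Literature.IUT.HodgeArakelov.RadialEnvironments
import Literature.IUT.HodgeArakelov.RadialExamples
import Literature.IUT.HodgeArakelov.RadialGraphs
import Literature.IUT.HodgeArakelov.AbsTopInterfaces
import Mathlib.CategoryTheory.Endomorphism
import Literature.AnabelianGeometry.EtaleTheta.Cyclotome

/-!
# [IUTchII] §1, Corollary 1.11 and Remarks 1.11.1–1.11.6: multiradial MLF-Galois pair cyclotomic rigidity
# with indeterminacies

Mochizuki, *Inter-universal Teichmüller theory II*, §1, kurims manuscript (Dec. 2020) pp. 49–55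
[claim: Mochizuki2012, status: disputed] (IUTchII §1 Cor 1.11 - Rmk 1.11.6, kurims pp.49-55). Record-only typing
under the claim key `Mochizuki2012` (D-0012, disputed). (Cor. 1.11 and Rmk. 1.11.1 / 1.11.3 are cited by
the proof of [IUTchIII] Cor. 3.12 — STATEMENT-CLOSURE §B; the mathematical sub-items are promoted to named
declarations here, C1.)

* `IUTchII:Cor1.11` — over the environment of Ex. 1.8 (viii): (a) the `Γ`-orbit `(*bs-Gal_{G,⊳})` of the
  cyclotomic rigidity isomorphism `μ_Ẑ(G) ≅ μ_Ẑ(O^×(G)) := Hom(ℚ/ℤ, O^×(G))` ([AbsTopIII] Rmk. 3.2.1) — the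
  latter realised by the tree's cyclotome `Λ(O^×(G)) = lim_n O^×(G)[n]` (L2-t3, p403711); (b)
  the `Aut(G)`-orbit `(*bs-Gal_{G,Π})` of isomorphisms `μ_Ẑ(G) ≅ (l·Δ_Θ)(Π)` (via `α : Π/Δ ≅ G` and
  [AbsTopIII] Cor. 1.10 (c)); the functor `ℛ → ℱ` these data determine, its graph `ℛ†`, and "`Ψ_ℛ : ℛ → ℛ†`
  is multiradially defined" — data as an INTERFACE structure (`GaloisPairRigidityData`,
  TODO-merge:abc-iut-L4-t1/L4-t2), `μ_Ẑ(O^×(G))` DEFINED, the orbits DEFINED, multiradiality PROVED in the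
  pair-environment model (printed proof: "follow immediately from the definitions involved").
* `IUTchII:Rmk1.11.1(i)` (a)–(d) and `(ii)` — automorphism groups of the pairs `G ↷ O^⊳(G)`, `G ↷ O^×(G)`,
  `G ↷ O^ĝp(G)` versus `Aut(G)` (bijective / surjective with kernel the `Ẑ^×`-action), divisibility of
  `O^{×μ}(G)`: `PairAut` DEFINED, the four claims as named `Prop`s; (ii) `Γ = Ẑ^×`.
* `IUTchII:Rmk1.11.2(i)` — the `Ẑ^×`-action on `Π ↷ O^×(G)` does not preserve the ring structure on
  `O^×(G) ⊗ ℚ` reconstructed from `Π` (named `Prop` over a ring-structure interface); `(ii)` expository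
  (why `G` and not `Π` in the Θ-link) — noted.
* `IUTchII:Rmk1.11.3(ii)` — induced indeterminacies on `O^×(G)`, `O^ĝp(G)`: expository here (noted; helper
  `unitsAut_unique_of_Oghat` PROVED); `IUTchII:Rmk1.11.3(iv)` — the uniradial environment eliminating the
  indeterminacy = `ex19iii S Q` of `RadialGraphs` (cross-reference); `IUTchII:Rmk1.11.3(i)`,
  `IUTchII:Rmk1.11.3(iii)`, `IUTchII:Rmk1.11.3(v)` expository (specification of coric data; post-anabelian input
  data; "existence vs content of reconstruction algorithms") — noted.
* `IUTchII:Rmk1.11.5(i)`/`(ii)` — the natural surjection `H¹(G, μ_Ẑ(G)) ↠ Ẑ` ([AbsTopIII] Cor. 1.10 (b)),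
  Kummer image = inverse image of `ℤ`, kernel "`O^×_k`" corically defined; the induced surjections
  `H¹(G, μ_Ẑ(M_TM(Π))) ↠ Ẑ`, `H¹(G, (l·Δ_Θ)(Π)) ↠ Ẑ` — INTERFACE structure `ValuationSurjection` + DEFINED
  transports.
* Deliberately NOT typed beyond this docstring (C1, expository): `IUTchII:Rmk1.11.4(i)`, `IUTchII:Rmk1.11.4(ii)`
  (splitting /
  decoupling of purely radial vs purely coric data; the modified version `(*)`), `IUTchII:Rmk1.11.6`
  ([pTeich]/[CanLift] analogy: "cyclotomes as skeleta of arithmetic holomorphic structures").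
-/

namespace Literature.IUT.HodgeArakelov

open CategoryTheory

universe u

variable {S : ThetaSetting.{u}}

/-! ## `μ_Ẑ(O^×(G)) := Hom(ℚ/ℤ, O^×(G))` -/

/-- **IUTchII:Cor1.11** (a) (kurims p. 49): `μ_Ẑ(O^×(G)) := Hom(ℚ/ℤ, O^×(G))`, the cyclotome of the
multiplicative group `O^×(G)`. Since `Hom(ℚ/ℤ, A) = lim_n Hom((1/n)ℤ/ℤ, A) = lim_n A[n] = Λ(A)` canonically, we
USE the tree's cyclotome `Λ(A)` (`Literature.AnabelianGeometry.EtaleTheta.cyclotome`, LANA §6.1, landed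
p403711 — one notion per concept, C9) applied to `A = O^×(G)` (DEFINED).
[claim: Mochizuki2012, status: disputed] (IUTchII §1 Cor 1.11, kurims p.49) -/
abbrev AbsTopMonoids.muZhatUnits (A : AbsTopMonoids S) (G : IsoClass S.Gk) : Type u :=
  Literature.AnabelianGeometry.EtaleTheta.cyclotome (A.Ounits G)

/-! ## Corollary 1.11 -/

/-- INTERFACE data of **IUTchII:Cor1.11** (kurims p. 49): per `G ≅ G_k`, the cyclotome `μ_Ẑ(G)` (a group
with `Aut(G)`-action through the cyclotomic character, [AbsAnab] Prop. 1.2.1 (vi)), the cyclotomic rigidity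
isomorphism `μ_Ẑ(G) ≅ μ_Ẑ(O^×(G))` "obtained by applying to the MLF-Galois pair determined by `G ↷ O^⊳(G)`
the algorithm applied to construct [the inverse of] the isomorphism `μ_Ẑ(M_TM) ≅ μ_Ẑ(G)` in [AbsTopIII],
Remark 3.2.1", and per `Π ≅ Π^tp_{X̲̲_k}` the natural isomorphism `μ_Ẑ(Π/Δ) ≅ (l·Δ_Θ)(Π)` "of [AbsTopIII],
Corollary 1.10, (c)", together with the transport of `μ_Ẑ(-)` along isomorphisms of topological groups.
TODO-merge:abc-iut-L4-t1 ([AbsTopIII] Cor. 1.10), abc-iut-L4-t2 ([AbsTopIII] Rmk. 3.2.1), abc-iut-L4-t4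
([AbsAnab] Prop. 1.2.1). [claim: Mochizuki2012, status: disputed] (IUTchII §1 Cor 1.11, kurims p.49) -/
structure GaloisPairRigidityData (A : AbsTopMonoids S) : Type (u + 1) where
  /-- `μ_Ẑ(G)` -/
  muZhat : IsoClass S.Gk → Type u
  [grpMu : ∀ G, CommGroup (muZhat G)]
  /-- transport of `μ_Ẑ(-)` along isomorphisms `G ≅ G*`: FUNCTORIAL ([AbsTopIII] Cor. 1.10 is a functorial
  group-theoretic algorithm) -/
  mapMu : ∀ {G H : IsoClass S.Gk}, (G ⟶ H) → (muZhat G ≃* muZhat H)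
  mapMu_id : ∀ G : IsoClass S.Gk, mapMu (𝟙 G) = MulEquiv.refl (muZhat G)
  mapMu_comp : ∀ {G H K : IsoClass S.Gk} (f : G ⟶ H) (g : H ⟶ K), mapMu (f ≫ g) = (mapMu f).trans (mapMu g)
  /-- the action of `Ẑ^×` (in particular of `Γ`) on `μ_Ẑ(G)`, compatible with transport -/
  twist : ∀ G, ZHatUnits →* MulAut (muZhat G)
  twist_natural : ∀ {G H : IsoClass S.Gk} (f : G ⟶ H) (u : ZHatUnits) (x : muZhat G),
    mapMu f (twist G u x) = twist H u (mapMu f x)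
  /-- (a) the cyclotomic rigidity isomorphism `μ_Ẑ(G) ≅ μ_Ẑ(O^×(G))` of [AbsTopIII] Rmk. 3.2.1, NATURAL in
  isomorphisms `G ≅ G*` (both sides being outputs of functorial algorithms; `μ_Ẑ(O^×(-))` is functorial via
  `cyclotome.map` of the induced isomorphism of units) -/
  bsGalTri : ∀ G, muZhat G ≃* A.muZhatUnits G
  bsGalTri_natural : ∀ {G H : IsoClass S.Gk} (f : G ⟶ H) (x : muZhat G),
    bsGalTri H (mapMu f x) =
      Literature.AnabelianGeometry.EtaleTheta.cyclotome.map (Units.map (A.mapOtri f).toMonoidHom) (bsGalTri G x)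
  /-- `(l·Δ_Θ)(Π)` ([EtTh] Cor. 2.18 (i)), as a commutative group, functorial in `Π` -/
  lDeltaTheta : IsoClass S.PiX → Type u
  [grpLD : ∀ P, CommGroup (lDeltaTheta P)]
  /-- (b) [AbsTopIII] Cor. 1.10 (c): `μ_Ẑ(Π/Δ) ≅ (l·Δ_Θ)(Π)`, with `Π/Δ` the object of `AbsTopMonoids.quotIso` -/
  corPiX : ∀ P : IsoClass S.PiX,
    muZhat ⟨TopGroup.quot P.G (A.Delta P), A.quotIso P⟩ ≃* lDeltaTheta P

attribute [instance] GaloisPairRigidityData.grpMu GaloisPairRigidityData.grpLD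

namespace GaloisPairRigidityData

variable {A : AbsTopMonoids S} (D : GaloisPairRigidityData A)

/-- **IUTchII:Cor1.11** (a) (kurims p. 49): "the `Γ`-orbit … `μ_Ẑ(G) ≅ μ_Ẑ(O^×(G))` `(*bs-Gal_{G,⊳})` of the
cyclotomic rigidity isomorphism", for a closed subgroup `Γ ⊆ Ẑ^×` (DEFINED as a set of isomorphisms).
[claim: Mochizuki2012, status: disputed] (IUTchII §1 Cor 1.11, kurims p.49) -/
def orbitA (Γ : Subgroup ZHatUnits) (G : IsoClass S.Gk) : Set (D.muZhat G ≃* A.muZhatUnits G) :=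
  {φ | ∃ γ ∈ Γ, φ = (D.twist G γ).trans (D.bsGalTri G)}

/-- **IUTchII:Cor1.11** (b) (kurims p. 49): "the `Aut(G)`-orbit … of isomorphisms `μ_Ẑ(G) ≅ (l·Δ_Θ)(Π)`
`(*bs-Gal_{G,Π})` obtained by composing the poly-isomorphism induced by applying `μ_Ẑ(-)` to the [inverse
of the] full poly-isomorphism of topological groups `α : Π/Δ ≅ G` [cf. Example 1.8, (i)] with the natural
isomorphism `μ_Ẑ(G_k) ≅ μ_Ẑ(Π_X)` of [AbsTopIII], Corollary 1.10, (c)" (DEFINED: all composites over all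
isomorphisms `G ≅ Π/Δ`). [claim: Mochizuki2012, status: disputed] (IUTchII §1 Cor 1.11, kurims p.49) -/
def orbitB (P : IsoClass S.PiX) (G : IsoClass S.Gk) : Set (D.muZhat G ≃* D.lDeltaTheta P) :=
  {φ | ∃ e : G ⟶ ⟨TopGroup.quot P.G (A.Delta P), A.quotIso P⟩, φ = (D.mapMu e).trans (D.corPiX P)}

end GaloisPairRigidityData

/-- **IUTchII:Cor1.11** (kurims p. 49) "(Multiradial MLF-Galois Pair Cyclotomic Rigidity Isomorphisms with
Indeterminacies)": "Write `(ℛ, 𝒞, Φ)` — i.e., in the notation of Example 1.8, (viii),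
`(Π ↷ M_TM(Π), G ↷ O^ĝp(G), α_{⊳,×μ}) ↦ (G ↷ O^{×μ}(G))` … Then the data consisting of the triple `(Π, G, α)`,
the topological `G`-modules constituted by the domain and codomain of `(*bs-Gal_{G,⊳})`, the topological
`Π`-module constituted by the codomain of `(*bs-Gal_{G,Π})`, and the poly-isomorphisms `(*bs-Gal_{G,⊳})` and
`(*bs-Gal_{G,Π})` determines a functor `ℛ → ℱ` which arises from a functorial algorithm in the triple
`(Π, G, α)`; denote the corresponding graph … by `ℛ†`. In particular, the resulting natural functor
`Ψ_ℛ : ℛ → ℛ†` … is multiradially defined." SHAPE THEOREM (as for Cor. 1.10): in the pair-environment model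
EVERY functor out of `ℛ = (ex18iii S Γ).R` is multiradially defined (printed proof: "follow immediately from the
definitions involved"); the specific functor `ℛ → ℱ` of the corollary (tuples built from
`GaloisPairRigidityData`: `muZhat`, `muZhatUnits`, `lDeltaTheta`, `orbitA`, `orbitB`) is NOT built here. The
abstract group `Γ : Type u` of the shape is the group underlying the closed subgroup `Γ ⊆ Ẑ^×` of `orbitA`
(universe-lifted). [claim: Mochizuki2012, status: disputed] (IUTchII §1 Cor 1.11, kurims p.49) -/
theorem cor111_multiradiallyDefined (S : ThetaSetting.{u}) (Γ : Type u) [Group Γ] {F : Type (u + 1)}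
    [Category.{u} F] (Ξ : (ex18iii S Γ).R ⥤ F) : ((ex18iii S Γ).toDagger Ξ).IsMultiradiallyDefined :=
  ex18iii_isMultiradial S Γ

/-! ## Remark 1.11.1: automorphisms of the pairs -/

/-- The action of `G` on `O^×(G) = (O^⊳(G))ˣ` induced from the action on `O^⊳(G)` (DEFINED).
[claim: Mochizuki2012, status: disputed] (IUTchII §1 Ex 1.8 (iii), kurims p.37) -/
def AbsTopMonoids.actOunits (A : AbsTopMonoids S) (G : IsoClass S.Gk) : G.G →* MulAut (A.Ounits G) where
  toFun g := Units.mapEquiv (A.actOtri G g)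
  map_one' := by ext u; simp
  map_mul' g h := by ext u; simp

/-- **IUTchII:Rmk1.11.1(i)** (kurims pp. 49–50): the group of automorphisms of a pair "`G ↷ M`" (an
[ind-topological] monoid with topological group action): pairs `(σ, ψ)` of an automorphism `σ` of the
topological group `G` and an automorphism `ψ` of `M` with `ψ(g·m) = σ(g)·ψ(m)` (DEFINED as a subgroup of
`Aut(G) × Aut(M)`). [claim: Mochizuki2012, status: disputed] (IUTchII §1 Rmk 1.11.1 (i), kurims pp.49-50) -/
def PairAut (G : IsoClass S.Gk) (M : Type u) [Monoid M] (act : G.G →* MulAut M) :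
    Subgroup (Aut G × MulAut M) where
  carrier := {p | ∀ (g : G.G) (m : M), p.2 (act g m) = act (IsoClass.homIso p.1.hom g) (p.2 m)}
  mul_mem' := by
    intro p q hp hq g m
    change p.2 (q.2 (act g m)) = act (IsoClass.homIso p.1.hom (IsoClass.homIso q.1.hom g)) (p.2 (q.2 m))
    rw [hq, hp]
  one_mem' := by
    intro g m
    rfl
  inv_mem' := by
    intro p hp g m
    change p.2.symm (act g m) = act (IsoClass.homIso p.1.inv g) (p.2.symm m)
    apply p.2.injective
    have hg : IsoClass.homIso p.1.hom (IsoClass.homIso p.1.inv g) = g := by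
      change IsoClass.homIso (p.1.inv ≫ p.1.hom) g = g
      rw [p.1.inv_hom_id]
      rfl
    rw [MulEquiv.apply_symm_apply, hp, MulEquiv.apply_symm_apply, hg]

/-- The forgetful map `Aut(G ↷ M) → Aut(G)`, "[i.e., by forgetting `M`]".
[claim: Mochizuki2012, status: disputed] (IUTchII §1 Rmk 1.11.1 (i), kurims p.50) -/
def PairAut.forget {G : IsoClass S.Gk} {M : Type u} [Monoid M] {act : G.G →* MulAut M}
    (p : PairAut G M act) : Aut G := p.1.1

/-- **IUTchII:Rmk1.11.1(i)** (a) (kurims pp. 49–50): "the group of automorphisms of the … MLF-Galois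
TM-pair … `G ↷ O^⊳(G)` maps bijectively [i.e., by forgetting `O^⊳(G)`] onto the group of automorphisms of
the topological group `G` [cf. [AbsTopIII], Proposition 3.2, (iv)]". Named fact over the interface.
[claim: Mochizuki2012, status: disputed] (IUTchII §1 Rmk 1.11.1 (i), kurims pp.49-50) -/
def Rmk1111_a (A : AbsTopMonoids S) : Prop :=
  ∀ G : IsoClass S.Gk, Function.Bijective (PairAut.forget (G := G) (act := A.actOtri G))

/-- **IUTchII:Rmk1.11.1(i)** (b) (kurims p. 50): for `G ↷ O^×(G)` the forgetful map "maps surjectively …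
onto the group of automorphisms of the topological group `G`, with kernel given by the [`G`-linear]
automorphisms of … `O^×(G)` determined by the natural action of `Ẑ^×` [cf. [AbsTopIII], Proposition 3.3,
(ii)]" — the `Ẑ^×`-action `x ↦ x^u` on the units is carried as `zhatPow` (interface datum: profinite
exponentiation on `O^×` is not in the tree). Kernel typed as the printed subgroup EQUALITY: every pair over
`1 ∈ Aut(G)` is a `Ẑ^×`-automorphism, and every `(1, x ↦ x^u)` is a pair (i.e. the `Ẑ^×`-action is
`G`-linear) — review of p407744. Named fact. [claim: Mochizuki2012, status: disputed] (IUTchII §1 Rmk 1.11.1 (i), kurims p.50) -/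
def Rmk1111_b (A : AbsTopMonoids S)
    (zhatPow : ∀ G : IsoClass S.Gk, ZHatUnits →* MulAut (A.Ounits G)) : Prop :=
  ∀ G : IsoClass S.Gk,
    Function.Surjective (PairAut.forget (G := G) (act := A.actOunits G)) ∧
    (∀ p : PairAut G (A.Ounits G) (A.actOunits G),
      PairAut.forget p = 1 → ∃ u : ZHatUnits, p.1.2 = zhatPow G u) ∧
    ∀ u : ZHatUnits, ((1 : Aut G), zhatPow G u) ∈ PairAut G (A.Ounits G) (A.actOunits G)

/-- **IUTchII:Rmk1.11.1(i)** (c) (kurims p. 50): the same surjectivity / kernel description for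
`G ↷ O^ĝp(G)` ("by the same proof involving the Kummer map … [or, equivalently, maps bijectively onto the
group of automorphisms of … `G ↷ O^×(G)`]"), over the `(*ĝp)` interface of Ex. 1.8 (vii). Named fact.
[claim: Mochizuki2012, status: disputed] (IUTchII §1 Rmk 1.11.1 (i), kurims p.50) -/
def Rmk1111_c (A : AbsTopMonoids S) {Γ : Type u} [Group Γ] (Pg : ProfiniteGroupifications A Γ)
    (actG : ∀ G : IsoClass S.Gk, G.G →* MulAut (Pg.Oghat G))
    (zhatPow : ∀ G : IsoClass S.Gk, ZHatUnits →* MulAut (Pg.Oghat G)) : Prop :=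
  ∀ G : IsoClass S.Gk,
    Function.Surjective (PairAut.forget (G := G) (act := actG G)) ∧
    (∀ p : PairAut G (Pg.Oghat G) (actG G),
      PairAut.forget p = 1 → ∃ u : ZHatUnits, p.1.2 = zhatPow G u) ∧
    ∀ u : ZHatUnits, ((1 : Aut G), zhatPow G u) ∈ PairAut G (Pg.Oghat G) (actG G)

/-- The `G`-action on `O^{×μ}(G) = O^×(G)/O^μ(G)` induced from `O^×(G)` (torsion is preserved by
automorphisms). [claim: Mochizuki2012, status: disputed] (IUTchII §1 Ex 1.8 (iv), kurims p.38) -/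
def AbsTopMonoids.actOxmu (A : AbsTopMonoids S) (G : IsoClass S.Gk) (g : G.G) :
    A.Oxmu G →* A.Oxmu G :=
  QuotientGroup.map (A.Omu G) (A.Omu G) (A.actOunits G g).toMonoidHom fun y hy => by
    simpa [AbsTopMonoids.Omu, CommGroup.mem_torsion] using (A.actOunits G g).toMonoidHom.isOfFinOrder hy

/-- **IUTchII:Rmk1.11.1(i)** (d) (kurims p. 50): "the underlying ind-topological module of `O^{×μ}(G)` is
divisible, hence admits a natural action by `ℚ_p`. In particular, if, in (b), one replaces `O^×` by
`O^{×μ}`, then the resulting description of the kernel is false." Typed: divisibility of `O^{×μ}(G)`, and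
the existence of a `G`-equivariant automorphism of `O^{×μ}(G)` not arising from `Ẑ^×` (via `Ism`). Named
fact. [claim: Mochizuki2012, status: disputed] (IUTchII §1 Rmk 1.11.1 (i), kurims p.50) -/
def Rmk1111_d (A : AbsTopMonoids S) : Prop :=
  ∀ G : IsoClass S.Gk,
    (∀ (n : ℕ), 0 < n → ∀ x : A.Oxmu G, ∃ y : A.Oxmu G, y ^ n = x) ∧
    ∃ ψ : MulAut (A.Oxmu G),
      (∀ (g : G.G) (x : A.Oxmu G), ψ (A.actOxmu G g x) = A.actOxmu G g (ψ x)) ∧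
      ∀ u : ZHatUnits, ψ ≠ A.actIsm G (A.toIsm G u)

/-- **IUTchII:Rmk1.11.1(ii)** (kurims p. 50): "In the present series of papers, we shall primarily be
interested in Corollary 1.11 in the case where `Γ = Ẑ^×`. That is to say, allowing for a `Γ (= Ẑ^×)`-
multiple indeterminacy corresponds precisely to working, in the case of `G ↷ O^×(G)`, with the underlying
ind-topological module equipped with topological group action [cf. (i), (b)]." The choice `Γ = Ẑ^×`
(DEFINED). [claim: Mochizuki2012, status: disputed] (IUTchII §1 Rmk 1.11.1 (ii), kurims p.50) -/
noncomputable abbrev fullGamma : Subgroup ZHatUnits := ⊤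

/-! ## Remark 1.11.2 (i): `Ẑ^×` versus the ring structure -/

/-- **IUTchII:Rmk1.11.2(i)** (kurims pp. 50–51): the `Ẑ^×`-action on `G ↷ O^×(G)` pulls back to
`Π ↷ O^×(G)`; "this action of `Ẑ^×` fails to be compatible with the ring structure on `O^×(G) ⊗ ℚ` [i.e.,
the ring structure determined by applying the `p`-adic logarithm] … reconstructed from `Π` [cf.
[AbsTopIII], Theorem 1.9]". Typed over the units `O^×(G)` of the interface `A` at `G`: `L` = "`O^×(G) ⊗ ℚ`"
(an additive group receiving `O^×(G)` via `toL`) with its ring multiplication `mul` (interface datum: the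
`p`-adic-logarithm ring structure, [AbsTopIII] Thm. 1.9, owner abc-iut-L4-t1) and a `Ẑ^×`-action `act` EXTENDING
the `Ẑ^×`-action `zhatPow` on the units (the same datum as in `Rmk1111_b`); the claim: some `u ∈ Ẑ^×` does not
act multiplicatively. (`AddAut L` is an ADDITIVE group in this Mathlib — `Mathlib.Algebra.Group.End`: "we give
`AddAut M` the structure of an additive group" — whence the `Multiplicative` wrapper on the target of `act`.) (`IUTchII:Rmk1.11.2(ii)` — why "`G`" rather than "`Π`" in the Θ-link of [IUTchI] Cor.
3.7 — is expository; noted.) [claim: Mochizuki2012, status: disputed] (IUTchII §1 Rmk 1.11.2 (i), kurims pp.50-51) -/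
def Rmk1112_i (A : AbsTopMonoids S) (G : IsoClass S.Gk) (zhatPow : ZHatUnits →* MulAut (A.Ounits G))
    (L : Type u) [AddCommGroup L] (toL : Additive (A.Ounits G) →+ L) (mul : L → L → L)
    (act : ZHatUnits →* Multiplicative (AddAut L)) : Prop :=
  (∀ (u : ZHatUnits) (x : A.Ounits G),
      (act u).toAdd (toL (Additive.ofMul x)) = toL (Additive.ofMul (zhatPow u x))) ∧
    ∃ (u : ZHatUnits) (x y : L), (act u).toAdd (mul x y) ≠ mul ((act u).toAdd x) ((act u).toAdd y)

/-! ## Remark 1.11.3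

`IUTchII:Rmk1.11.3(ii)` (kurims p. 52: "the condition of compatibility with respect to the natural maps
`O^ĝp(G) ↩ O^×(G) ↠ O^{×μ}(G)` … implies that the (Aut(G), Γ)-indeterminacy on `G ↷ O^{×μ}(G)` induces an
(Aut(G), Γ)-indeterminacy on `G ↷ O^×(G)` and `G ↷ O^ĝp(G)`") is EXPOSITORY here — noted, not typed (typing it
faithfully needs the lifting of indeterminacies through the compatibility condition, i.e. the `G`- and
`Ẑ^×`-structures on `O^ĝp(G)`, which the interface does not carry); the helper below is the injectivity step used
in that discussion. `IUTchII:Rmk1.11.3(iv)` (p. 53: eliminating the indeterminacy by working with the uniradial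
environment `(Π ↷ M_TM(Π)) ↦ (Π/Δ ↷ M^{×μ}_TM(Π))` "in the fashion of Example 1.9, (iv), (b)") is, in the
pair-environment model, the Ex. 1.9 (iii) environment `ex19iii S Q` of the quotient functor (`RadialGraphs`) —
cross-reference, no second name. `(i)`, `(iii)`, `(v)`: expository, noted. -/

/-- Helper used in the discussion of Rmk. 1.11.3 (ii): an automorphism of `O^×(G)` compatible, through the
injection `O^×(G) ↪ O^ĝp(G)`, with a given automorphism of `O^ĝp(G)` is unique. PROVED from
`unitsToOghat_injective`. [claim: Mochizuki2012, status: disputed] (IUTchII §1 Rmk 1.11.3 (ii), kurims p.52) -/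
theorem unitsAut_unique_of_Oghat (A : AbsTopMonoids S) {Γ : Type u} [Group Γ]
    (Pg : ProfiniteGroupifications A Γ) (G : IsoClass S.Gk) (ψ ψ' : MulAut (A.Ounits G))
    (χ : MulAut (Pg.Oghat G)) (h : ∀ x, Pg.unitsToOghat G (ψ x) = χ (Pg.unitsToOghat G x))
    (h' : ∀ x, Pg.unitsToOghat G (ψ' x) = χ (Pg.unitsToOghat G x)) : ψ = ψ' := by
  ext x
  exact congrArg Units.val (Pg.unitsToOghat_injective G ((h x).trans (h' x).symm))

/-! ## Remark 1.11.5: the valuation surjection `H¹(G, μ_Ẑ(G)) ↠ Ẑ` -/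

/-- **IUTchII:Rmk1.11.5(i)** (kurims p. 55), INTERFACE: "the natural surjection `H¹(G, μ_Ẑ(G)) ↠ Ẑ` — which
is constructed via a functorial group-theoretic algorithm in [AbsTopIII], Corollary 1.10, (b). … when
`G = G_k`, this surjection is the surjection determined by the valuation of `k` on the image of the natural
Kummer map `k^× ↪ H¹(G_k, μ_Ẑ(G_k))` — where we recall that the image of this Kummer map is equal to the
inverse image of `ℤ ⊆ Ẑ`"; "its kernel, i.e., `O^×_k` — may be formulated as a corically, hence, in
particular, as a multiradially, defined functor." DATA per `G` (cohomology group, surjection, Kummer map)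
with the printed properties; TODO-merge:abc-iut-L4-t1 ([AbsTopIII] Cor. 1.10 (b)).
[claim: Mochizuki2012, status: disputed] (IUTchII §1 Rmk 1.11.5 (i), kurims p.55) -/
structure ValuationSurjection (S : ThetaSetting.{u}) : Type (u + 1) where
  /-- `H¹(G, μ_Ẑ(G))` (additively written) -/
  H1 : IsoClass S.Gk → Type u
  [grpH1 : ∀ G, AddCommGroup (H1 G)]
  /-- the natural surjection `H¹(G, μ_Ẑ(G)) ↠ Ẑ` -/
  val : ∀ G, H1 G →+ Additive Literature.IUT.HodgeTheaters.ZHat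
  val_surjective : ∀ G, Function.Surjective (val G)
  /-- functoriality in isomorphisms of `G` (a functorial group-theoretic algorithm; the surjection is
  corically defined): functor laws and naturality of `val` -/
  mapH1 : ∀ {G H : IsoClass S.Gk}, (G ⟶ H) → (H1 G ≃+ H1 H)
  mapH1_id : ∀ G : IsoClass S.Gk, mapH1 (𝟙 G) = AddEquiv.refl (H1 G)
  mapH1_comp : ∀ {G H K : IsoClass S.Gk} (f : G ⟶ H) (g : H ⟶ K), mapH1 (f ≫ g) = (mapH1 f).trans (mapH1 g)
  val_natural : ∀ {G H : IsoClass S.Gk} (e : G ⟶ H) (x : H1 G), val H (mapH1 e x) = val G x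
  /-- the Kummer map `k^× ↪ H¹(G_k, μ_Ẑ(G_k))` at the base object -/
  kummer : S.kˣ →* Multiplicative (H1 (IsoClass.base S.Gk))
  kummer_injective : Function.Injective kummer
  /-- "the image of this Kummer map is equal to the inverse image of `ℤ ⊆ Ẑ`" — `ℤ ⊆ Ẑ` being the canonical
  map into the profinite completion (`Literature.IUT.HodgeTheaters.toCompletion`, DEFINED in the tree) -/
  kummer_range : ∀ x : H1 (IsoClass.base S.Gk),
    (∃ a : S.kˣ, kummer a = Multiplicative.ofAdd x) ↔
      ∃ n : ℤ, val _ x = Additive.ofMul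
        (Literature.IUT.HodgeTheaters.toCompletion (Multiplicative ℤ) (Multiplicative.ofAdd n))

attribute [instance] ValuationSurjection.grpH1

/-- **IUTchII:Rmk1.11.5(i)**: "`O^×_k`", the kernel of the valuation surjection (DEFINED), a corically defined
datum. [claim: Mochizuki2012, status: disputed] (IUTchII §1 Rmk 1.11.5 (i), kurims p.55) -/
noncomputable abbrev ValuationSurjection.unitsKernel (V : ValuationSurjection S) (G : IsoClass S.Gk) :
    AddSubgroup (V.H1 G) :=
  (V.val G).ker

/-- **IUTchII:Rmk1.11.5(ii)** (kurims p. 55): "if one applies the isomorphisms `(*bs-Gal_{G,⊳})` … and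
`(*bs-Gal_{G,Π})` of Corollary 1.11, then the natural surjection of (i) gives rise to natural surjections
`H¹(G, μ_Ẑ(M_TM(Π))) ↠ Ẑ`; `H¹(G, (l·Δ_Θ)(Π)) ↠ Ẑ` — which yield data that may be formulated either as a
uniradially defined functor [cf. Remark 1.11.3, (iv)] or, when considered up to a `Ẑ^×`-indeterminacy, as a
multiradially defined functor [cf. Corollary 1.11]. In particular, the kernels of these natural surjections
yield data that may be formulated as a multiradially defined functor." DEFINED: the surjection transported
along an isomorphism of coefficient cohomology groups (the induced map on `H¹` being an interface datum).
[claim: Mochizuki2012, status: disputed] (IUTchII §1 Rmk 1.11.5 (ii), kurims p.55) -/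
noncomputable def ValuationSurjection.transport (V : ValuationSurjection S) (G : IsoClass S.Gk) {H1' : Type u}
    [AddCommGroup H1'] (e : H1' ≃+ V.H1 G) : H1' →+ Additive Literature.IUT.HodgeTheaters.ZHat :=
  (V.val G).comp e.toAddMonoidHom

/-- **IUTchII:Rmk1.11.5(ii)**, PROVED (definitional): the transported surjection is surjective and its kernel
is the transported kernel "`O^×_k`". [claim: Mochizuki2012, status: disputed] (IUTchII §1 Rmk 1.11.5 (ii), kurims p.55) -/
theorem ValuationSurjection.transport_surjective (V : ValuationSurjection S) (G : IsoClass S.Gk)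
    {H1' : Type u} [AddCommGroup H1'] (e : H1' ≃+ V.H1 G) :
    Function.Surjective (V.transport G e) ∧
      (V.transport G e).ker = (V.unitsKernel G).comap e.toAddMonoidHom :=
  ⟨(V.val_surjective G).comp e.surjective, rfl⟩

end Literature.IUT.HodgeArakelov
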